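import Mathlib
import Literature.MathematicalPhysics.QuantumFieldTheory.Balaban1983to89.T4EtaRateDefect
import Literature.MathematicalPhysics.QuantumFieldTheory.Balaban1983to89.B11AxialTransport190

/-!
# `Balaban1983to89.T4EtaRateDefectSite` — the SITE-KERNEL READOUT of `T4EtaRateDefect`: from block majorants of the
two-run defect to the typed NE2⁺ site-kernel shape `T4EtaRate.EtaRateIneqSite` / `NE2PlusSite`, BY NAME

Cell `pub-balaban`, unit `b2b-balaban-pv25-g13` (the η-rate lineage of `T4EtaRate` / `T4EtaRateMin` / `T4EtaRateDefect`;
T4-DAG node U1a = the NE2 background layer, record `t4/T4-EST-U1a.md` §3 STEP 3 = NE2-ALG, §9).  Second kernel leaf of the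
self-row T4-U1a.S-NE2-DEFECT-CALCULUS° (first leaf: `T4EtaRateDefect`, whose MAIN theorem `idef_neumann_majorant` bounds the
intertwining defect `𝔇(A′,A) = A′τ₁ − τ₂A` of two runs' Neumann fixed points by a SOURCE-WEIGHTED block majorant
`c·e^{−ρd(y,y′)}·w(y′)` in the abstract block norms of `B11SectG`).

WHAT THIS MODULE ADDS (mechanism only, 0 sorry, every declaration [folklore] or a shape-location).  The row's typed NE2⁺
shapes (`T4EtaRate.EtaRateIneqSite`, `T4EtaRate.NE2PlusSite`) are POINTWISE kernel inequalities on 𝔅 × 𝔅 in the printed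
format of [B9] Theorem 3.2 (3.48) p. 398 [PDF 10] (verbatim, as carried by the cross-read tree header `B9.lean`): *"Under the
assumptions of Theorem 3.1, and with the same constants, the following inequality holds: |(Q′(U)G′²(U)Q′\*(U))^{−1}(y, y′)|
≤ B₀(L^jη)^{−4}(L^{j′}η)^{−d} e^{−δ₀d(y,y′)}, y, y′ ∈ 𝔅 (y ∈ Λ_j, y′ ∈ Λ_{j′}) (3.48)."* — with, for the η-difference, the
additional rate factor `max((η/L^jη)^γ, (η/L^{j′}η)^γ)` of the row (NOT PRINTED; `T4EtaRate` §3).  The passage from block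
majorants to such pointwise inequalities is a DICTIONARY, kernel-checked here:
* §1 `entry T x x′ := T(δ_{x′})(x)` (the matrix entry of a linear map between lattice-function spaces) and the READOUT
  lemmas for the sharp-block sup norms `B11SectG.BlockNorm.ofBlocks` reweighted by site weights (`T4EtaRateDefect.wnorm`):
  `isLoc_ofBlocks_single`, `loc_ofBlocks_single` (= 1), `loc_ofBlocks_id` (= |f y|), `entry_le_of_hasMaj`,
  `entry_le_of_hasMaj_wnorm` (`w₂(y)·|entry| ≤ K(y,y′)·w₁(y′)`), and for SITE kernels (blocks = single sites) the
  EQUIVALENCE `hasMaj_wnorm_site_iff`: a weighted block majorant IS a (3.48)-type pointwise majorant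
  `w₂(y)|t(y,y′)| ≤ K(y,y′)w₁(y′)` — so the (3.48) normalisation `(L^jη)^{−p}(L^{j′}η)^{−d}` is the pair of weights
  `w₂ = (L^jη)^{p}` (observation), `w₁ = (L^{j′}η)^{−d}` (source): `srcNorm`, `obsNorm` below.
* §2 the B9 site layer: the (3.48) normalisations `srcNorm d` / `obsNorm blk′ p` and the dictionary on 𝔅 `hasMaj_site_iff`
  (`(L^jη)^p·|t(y,y′)| ≤ K(y,y′)·(L^{j′}η)^{−d}` ⟺ block majorant `K`), `defectKernel ι D : B9.SiteKernel g Bf` (the defect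
  family `D U : (𝔅 → ℝ) →ₗ (X′ → ℝ)` read at the paired sites, `ι : 𝔅 → X′` a section of the fine block map `blk′` — the
  site-identification convention (C1) of the record `t4/T4-EST-U1a.md` §1.2), the one-configuration
  PRODUCER `etaRateIneqSite_of_hasMaj` (a block majorant `C·e^{−δd}·rateWeight γ (y′)` between `srcNorm d` and `obsNorm p`
  ⟹ `EtaRateIneqSite d p (defectKernel ι D) C δ γ U`, using `T4EtaRateDefect.rateWeight_toB6` and `rateFactor y′ ≤ max`), and
  the uniform wrapper `ne2PlusSite_of_hasMaj` producing the row's `NE2PlusSite` from the SAME quantifier block over uniform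
  block majorants — the NE2⁺ site layer is thereby PRODUCED BY NAME from block-majorant hypotheses; nothing is asserted.
* §3 the COMPOSED producer `etaRateIneqSite_of_primitives`: `T4EtaRateDefect.idef_neumann_majorant_rateWeight` (MAIN of the
  first leaf, with its smallness/gap census (N1)–(N6)) run in the (3.48)-normalised norms and read out — from the primitive
  defects' majorants, the coarse run's majorant at rate `ρ + γ·ln L/(RM)`, the fine run's uniform convergence and [B6] (2.60)
  to `EtaRateIneqSite d p … ((ε_S + κ₂m_KA₀L^γ)(1 − m′)⁻¹) ρ γ U`.
* §4 non-vacuity on the one-point instance (`pt9Geo`, `pt9Bg`): the producer's hypotheses are met by the scalar model of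
  `T4EtaRateDefect` §5 and return `|a′ − a|` as the constant (`etaRateIneqSite_pt`).

HONEST LIMITS.  (a) SITE layer only: the OPERATOR layer `T4EtaRate.EtaRateIneq342` quantifies over the abstract argument
type `g.Loc` of `B9.Geometry` (supports `suppIn`, size `supNorm`), for which no realisation as lattice functions is fixed in
the tree; its readout would need such a realisation map and is NOT attempted.  (b) Mechanism only, as in the first leaf: no
propagator of [B6]/[B9] is constructed, no primitive defect rate is proved (census item (N3) of `T4EtaRateDefect` — NOT
PRINTED, the located content of NE2⁺), operator domains are not modelled.  (c) The [B9] display (3.48) above and [B6] (2.60)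
(inside `T4EtaRateDefect`) are the only print loci used, both RE-USED from cross-read tree headers; [King1986] Prop. 3.9 (3.73)
p. 665 is cited for the exponent γ only (through `T4EtaRate.rateFactor`).  NOT NE2⁺, NOT summit progress (rung (B)+1
finite-T⁴ scoping; no mass gap; not Clay).

Imports BY NAME, nothing modified: `T4EtaRateDefect` (own lineage, p187412), `B11AxialTransport190` (b11 lineage:
`abs_le_loc_ofBlocks`, `loc_ofBlocks_le`).
-/

namespace Literature.MathematicalPhysics.QuantumFieldTheory.Balaban1983to89.T4EtaRateDefectSite

open Literature.MathematicalPhysics.QuantumFieldTheory.Balaban1983to89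
open B6RandomWalk B11SectG B9SectDWeightedNeumann T4EtaRateDefect B11AxialTransport190

noncomputable section

/-! ## §1 Matrix entries and the readout of sharp-block sup majorants -/

section Readout

variable {g : B6.Geometry}
variable {X₁ X₂ : Type} [DecidableEq X₁]

/-- The MATRIX ENTRY of a linear map between lattice-function spaces: `entry T x x′ = (T δ_{x′})(x)`. [folklore] -/
def entry (T : (X₁ → ℝ) →ₗ[ℝ] (X₂ → ℝ)) (x : X₂) (x' : X₁) : ℝ := T (Pi.single x' 1) x

/-- Unfolding of `entry`. [folklore] -/
@[simp] theorem entry_apply (T : (X₁ → ℝ) →ₗ[ℝ] (X₂ → ℝ)) (x : X₂) (x' : X₁) :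
    entry T x x' = T (Pi.single x' 1) x := rfl

/-- Entries are linear in the operator: `entry (T − S) = entry T − entry S`. [folklore] -/
theorem entry_sub (T S : (X₁ → ℝ) →ₗ[ℝ] (X₂ → ℝ)) (x : X₂) (x' : X₁) :
    entry (T - S) x x' = entry T x x' - entry S x x' := by
  simp [entry]

variable [Fintype X₁] [Fintype X₂]

/-- A delta function at `x′` is localised in the block of `x′`. [folklore] -/
theorem isLoc_ofBlocks_single (blk : X₁ → g.Site) (x' : X₁) (c : ℝ) :
    (BlockNorm.ofBlocks g blk).IsLoc (blk x') (Pi.single x' c : X₁ → ℝ) := by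
  show ∀ x, blk x ≠ blk x' → (Pi.single x' c : X₁ → ℝ) x = 0
  intro x hx
  have hne : x ≠ x' := fun h => hx (h ▸ rfl)
  simp [Pi.single_eq_of_ne hne]

/-- The sharp-block sup size of `δ_{x′}` near the block of `x′` is `1`. [folklore] -/
theorem loc_ofBlocks_single (blk : X₁ → g.Site) (x' : X₁) :
    (BlockNorm.ofBlocks g blk).loc (blk x') (Pi.single x' (1 : ℝ)) = 1 := by
  apply le_antisymm
  · refine loc_ofBlocks_le blk _ zero_le_one (fun x _ => ?_)
    by_cases h : x = x'
    · subst h; simp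
    · simp [Pi.single_eq_of_ne h]
  · simpa using abs_le_loc_ofBlocks blk (Pi.single x' (1 : ℝ)) (x' := x') rfl

/-- With single-site blocks (`blk = id` on 𝔅) the sharp-block sup size near `y` is `|f y|`. [folklore] -/
theorem loc_ofBlocks_id (f : g.Site → ℝ) (y : g.Site) :
    (BlockNorm.ofBlocks g (fun y : g.Site => y)).loc y f = |f y| := by
  apply le_antisymm
  · exact loc_ofBlocks_le (fun y : g.Site => y) f (abs_nonneg _) (fun x hx => by rw [hx])
  · exact abs_le_loc_ofBlocks (fun y : g.Site => y) f rfl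

/-- READOUT (unweighted): a block majorant bounds every matrix entry, `|T(δ_{x′})(x)| ≤ K(y(x), y(x′))`. [folklore] -/
theorem entry_le_of_hasMaj (blk₁ : X₁ → g.Site) (blk₂ : X₂ → g.Site) {T : (X₁ → ℝ) →ₗ[ℝ] (X₂ → ℝ)}
    {K : g.Site → g.Site → ℝ} (h : HasMaj (BlockNorm.ofBlocks g blk₁) (BlockNorm.ofBlocks g blk₂) T K)
    (x : X₂) (x' : X₁) : |entry T x x'| ≤ K (blk₂ x) (blk₁ x') := by
  have H := h (blk₁ x') (Pi.single x' 1) (isLoc_ofBlocks_single blk₁ x' 1) (blk₂ x)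
  rw [loc_ofBlocks_single, mul_one] at H
  exact (abs_le_loc_ofBlocks blk₂ _ rfl).trans H

/-- READOUT (weighted): a block majorant between REWEIGHTED sharp-block sup norms bounds every matrix entry,
`w₂(y(x))·|T(δ_{x′})(x)| ≤ K(y(x), y(x′))·w₁(y(x′))`. [folklore] -/
theorem entry_le_of_hasMaj_wnorm (blk₁ : X₁ → g.Site) (blk₂ : X₂ → g.Site) {w₁ w₂ : g.Site → ℝ}
    (hw₁ : ∀ y, 0 ≤ w₁ y) (hw₂ : ∀ y, 0 ≤ w₂ y) {T : (X₁ → ℝ) →ₗ[ℝ] (X₂ → ℝ)} {K : g.Site → g.Site → ℝ}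
    (h : HasMaj (wnorm (BlockNorm.ofBlocks g blk₁) w₁ hw₁) (wnorm (BlockNorm.ofBlocks g blk₂) w₂ hw₂) T K)
    (x : X₂) (x' : X₁) : w₂ (blk₂ x) * |entry T x x'| ≤ K (blk₂ x) (blk₁ x') * w₁ (blk₁ x') := by
  have H : w₂ (blk₂ x) * (BlockNorm.ofBlocks g blk₂).loc (blk₂ x) (T (Pi.single x' 1)) ≤
      K (blk₂ x) (blk₁ x') * (w₁ (blk₁ x') * (BlockNorm.ofBlocks g blk₁).loc (blk₁ x') (Pi.single x' 1)) :=
    h (blk₁ x') (Pi.single x' 1) (isLoc_ofBlocks_single blk₁ x' 1) (blk₂ x)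
  rw [loc_ofBlocks_single, mul_one] at H
  exact le_trans (mul_le_mul_of_nonneg_left (abs_le_loc_ofBlocks blk₂ _ rfl) (hw₂ _)) H

variable [DecidableEq g.Site]

/-- A lattice function localised at the single site `y′` is a multiple of `δ_{y′}`. [folklore] -/
theorem eq_single_of_isLoc_id {μ : g.Site → ℝ} {y' : g.Site}
    (hμ : (BlockNorm.ofBlocks g (fun y : g.Site => y)).IsLoc y' μ) : μ = μ y' • Pi.single y' (1 : ℝ) := by
  have hμ' : ∀ x, x ≠ y' → μ x = 0 := hμ
  funext x
  by_cases hx : x = y'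
  · subst hx; simp
  · simp [Pi.single_eq_of_ne hx, hμ' x hx]

/-- THE DICTIONARY for SITE KERNELS (blocks = single sites of 𝔅 on both sides): a block majorant `K` between the
reweighted sup norms IS the (3.48)-type pointwise majorant `w₂(y)·|t(y,y′)| ≤ K(y,y′)·w₁(y′)` of the matrix entries.
[cite: Balaban1985BackgroundPropagators, Thm 3.2 (3.48) p.398 (shape)] -/
theorem hasMaj_wnorm_site_iff {w₁ w₂ : g.Site → ℝ} (hw₁ : ∀ y, 0 ≤ w₁ y) (hw₂ : ∀ y, 0 ≤ w₂ y)
    {T : (g.Site → ℝ) →ₗ[ℝ] (g.Site → ℝ)} {K : g.Site → g.Site → ℝ} :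
    HasMaj (wnorm (BlockNorm.ofBlocks g (fun y : g.Site => y)) w₁ hw₁)
        (wnorm (BlockNorm.ofBlocks g (fun y : g.Site => y)) w₂ hw₂) T K ↔
      ∀ y y' : g.Site, w₂ y * |entry T y y'| ≤ K y y' * w₁ y' := by
  constructor
  · intro h y y'
    exact entry_le_of_hasMaj_wnorm (fun y : g.Site => y) (fun y : g.Site => y) hw₁ hw₂ h y y'
  · intro h y' μ hμ y
    have hμe : μ = μ y' • Pi.single y' (1 : ℝ) := eq_single_of_isLoc_id hμ
    show w₂ y * (BlockNorm.ofBlocks g (fun y : g.Site => y)).loc y (T μ) ≤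
      K y y' * (w₁ y' * (BlockNorm.ofBlocks g (fun y : g.Site => y)).loc y' μ)
    rw [loc_ofBlocks_id, loc_ofBlocks_id, hμe, map_smul]
    have e1 : |(μ y' • T (Pi.single y' (1 : ℝ))) y| = |μ y'| * |entry T y y'| := by
      simp [entry, abs_mul]
    have e2 : |(μ y' • Pi.single y' (1 : ℝ)) y'| = |μ y'| := by simp
    rw [e1, e2]
    have := h y y'
    have hμ0 : 0 ≤ |μ y'| := abs_nonneg _
    calc w₂ y * (|μ y'| * |entry T y y'|) = |μ y'| * (w₂ y * |entry T y y'|) := by ring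
      _ ≤ |μ y'| * (K y y' * w₁ y') := mul_le_mul_of_nonneg_left this hμ0
      _ = K y y' * (w₁ y' * |μ y'|) := by ring

end Readout

/-! ## §2 The B9 site layer: the defect kernel and the producers of `EtaRateIneqSite` / `NE2PlusSite` -/

section Norms

variable (g₉ : B9.Geometry)

/-- Site lengths are nonnegative when `L, η ≥ 0`. [folklore] -/
theorem len_nonneg (hL : 0 ≤ g₉.L) (hη : 0 ≤ g₉.eta) (y : g₉.Site) : 0 ≤ g₉.len y :=
  mul_nonneg (pow_nonneg hL _) hη

/-- Site lengths are positive when `L, η > 0`. [folklore] -/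
theorem len_pos (hL : 0 < g₉.L) (hη : 0 < g₉.eta) (y : g₉.Site) : 0 < g₉.len y :=
  mul_pos (pow_pos hL _) hη

variable [Fintype g₉.Site] (R : ℝ) (H : Prop)

/-- The SOURCE normalisation of (3.48): single-site blocks on 𝔅, weight `(L^{j′}η)^{−d}`. [cite: Balaban1985BackgroundPropagators, Thm 3.2 (3.48) p.398 (shape)] -/
def srcNorm (hL : 0 ≤ g₉.L) (hη : 0 ≤ g₉.eta) (d : ℕ) : BlockNorm (B9Thm34Ext.toB6 g₉ R H) (g₉.Site → ℝ) :=
  wnorm (BlockNorm.ofBlocks (B9Thm34Ext.toB6 g₉ R H) (fun y : g₉.Site => y))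
    (fun y : g₉.Site => g₉.len y ^ (-(d : ℝ))) (fun y => Real.rpow_nonneg (len_nonneg g₉ hL hη y) _)

/-- The OBSERVATION normalisation of (3.48) for lattice functions on a fine site set `X′` blocked over 𝔅 by `blk′`:
weight `(L^{j}η)^{p}`. [cite: Balaban1985BackgroundPropagators, Thm 3.2 (3.48) p.398 (shape)] -/
def obsNorm (hL : 0 ≤ g₉.L) (hη : 0 ≤ g₉.eta) {X' : Type} [Fintype X'] (blk' : X' → g₉.Site) (p : ℝ) :
    BlockNorm (B9Thm34Ext.toB6 g₉ R H) (X' → ℝ) :=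
  wnorm (BlockNorm.ofBlocks (B9Thm34Ext.toB6 g₉ R H) blk')
    (fun y : g₉.Site => g₉.len y ^ p) (fun y => Real.rpow_nonneg (len_nonneg g₉ hL hη y) _)

/-- The cutting cost of the observation norm is `1` (sharp blocks). [folklore] -/
theorem obsNorm_κ (hL : 0 ≤ g₉.L) (hη : 0 ≤ g₉.eta) {X' : Type} [Fintype X'] (blk' : X' → g₉.Site) (p : ℝ) :
    (obsNorm g₉ R H hL hη blk' p).κ = 1 := rfl

end Norms

section Kernel

variable {g₉ : B9.Geometry} [DecidableEq g₉.Site]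

/-- THE DEFECT SITE KERNEL: a family `D U : (𝔅 → ℝ) →ₗ (X′ → ℝ)` of coarse-to-fine linear maps (in applications
`D U = 𝔇(A′(U), A(Ū))`, `T4EtaRateDefect.idef`) read at the paired sites `(ι y, y′)`, `ι : 𝔅 → X′` the (C1) embedding
of the coarse sites into the fine lattice (record `t4/T4-EST-U1a.md` §1.2). [folklore] -/
def defectKernel {Bf : B9.Backgrounds} {X' : Type} (ι : g₉.Site → X')
    (D : Bf.Cfg → ((g₉.Site → ℝ) →ₗ[ℝ] (X' → ℝ))) : B9.SiteKernel g₉ Bf :=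
  ⟨fun U y y' => entry (D U) (ι y) y'⟩

/-- Unfolding of `defectKernel`: its kernel at `(U, y, y′)` is the matrix entry `(D U)(δ_{y′})(ι y)`. [folklore] -/
@[simp] theorem defectKernel_ker {Bf : B9.Backgrounds} {X' : Type} (ι : g₉.Site → X')
    (D : Bf.Cfg → ((g₉.Site → ℝ) →ₗ[ℝ] (X' → ℝ))) (U : Bf.Cfg) (y y' : g₉.Site) :
    (defectKernel ι D).ker U y y' = entry (D U) (ι y) y' := rfl

end Kernel

section Producers

variable {g₉ : B9.Geometry} [Fintype g₉.Site] [DecidableEq g₉.Site] {R : ℝ} {H : Prop}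

/-- THE (3.48) DICTIONARY on 𝔅 (site kernels, coarse-to-coarse): a block majorant `K` from `srcNorm d` to the single-site
observation norm `obsNorm id p` IS the pointwise inequality `(L^jη)^{p}·|t(y,y′)| ≤ K(y,y′)·(L^{j′}η)^{−d}`.
[cite: Balaban1985BackgroundPropagators, Thm 3.2 (3.48) p.398 (shape)] -/
theorem hasMaj_site_iff (hL : 0 ≤ g₉.L) (hη : 0 ≤ g₉.eta) {d : ℕ} {p : ℝ}
    {T : (g₉.Site → ℝ) →ₗ[ℝ] (g₉.Site → ℝ)} {K : g₉.Site → g₉.Site → ℝ} :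
    HasMaj (srcNorm g₉ R H hL hη d) (obsNorm g₉ R H hL hη (fun y : g₉.Site => y) p) T K ↔
      ∀ y y' : g₉.Site, g₉.len y ^ p * |entry T y y'| ≤ K y y' * g₉.len y' ^ (-(d : ℝ)) := by
  -- the `DecidableEq` instance on `(toB6 g₉ R H).Site = g₉.Site` is passed BY HAND (it must be the ambient one, so that
  -- `entry` on both sides is the same term; instance search does not unfold `toB6`).
  exact @hasMaj_wnorm_site_iff (B9Thm34Ext.toB6 g₉ R H) ‹DecidableEq g₉.Site› _ _ _ _ T K

/-- **PRODUCER, one configuration.**  A block majorant `C·e^{−δd(y,y′)}·(L^{j′})^{−γ}` of the defect map `D U` between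
the (3.48)-normalised norms (`srcNorm d` → `obsNorm blk′ p`) IS the row's site-kernel inequality `EtaRateIneqSite d p`
for the defect kernel read along a section `ι` of the fine block map, with the max-rate-factor (the source factor
`(η/L^{j′}η)^γ = (L^{j′})^{−γ}` is one of the two). [cite: Balaban1985BackgroundPropagators, Thm 3.2 (3.48) p.398 (shape); King1986, Prop. 3.9 (3.73) p.665 (the exponent γ)] -/
theorem etaRateIneqSite_of_hasMaj {Bf : B9.Backgrounds} {X' : Type} [Fintype X'] (blk' : X' → g₉.Site)
    (ι : g₉.Site → X') (hι : ∀ y, blk' (ι y) = y) (hL : 0 < g₉.L) (hη : 0 < g₉.eta)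
    {d : ℕ} {p C δ γ : ℝ} (hC : 0 ≤ C) (D : Bf.Cfg → ((g₉.Site → ℝ) →ₗ[ℝ] (X' → ℝ))) (U : Bf.Cfg)
    (h : HasMaj (srcNorm g₉ R H hL.le hη.le d) (obsNorm g₉ R H hL.le hη.le blk' p) (D U)
      (fun y y' => C * Real.exp (-(δ * g₉.dist y y')) * rateWeight (B9Thm34Ext.toB6 g₉ R H) γ y')) :
    T4EtaRate.EtaRateIneqSite d p (defectKernel ι D) C δ γ U := by
  intro y y'
  have E := entry_le_of_hasMaj_wnorm (g := B9Thm34Ext.toB6 g₉ R H) (fun y : g₉.Site => y) blk' _ _ h (ι y) y'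
  simp only [hι] at E
  rw [rateWeight_toB6 g₉ R H hη.ne' hL] at E
  -- E : len y ^ p * |entry| ≤ C * exp * rateFactor y' * len y' ^ (-d)
  have hlen : 0 < g₉.len y := len_pos g₉ hL hη y
  have hlenp : 0 < g₉.len y ^ p := Real.rpow_pos_of_pos hlen p
  have E' : |entry (D U) (ι y) y'| ≤
      C * Real.exp (-(δ * g₉.dist y y')) * T4EtaRate.rateFactor g₉ γ y' * g₉.len y' ^ (-(d : ℝ)) *
        (g₉.len y ^ p)⁻¹ := by
    rw [le_mul_inv_iff₀ hlenp]
    linarith [E]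
  rw [← Real.rpow_neg hlen.le] at E'
  have hexp : 0 ≤ Real.exp (-(δ * g₉.dist y y')) := (Real.exp_pos _).le
  have hfac : 0 ≤ C * g₉.len y ^ (-p) * g₉.len y' ^ (-(d : ℝ)) * Real.exp (-(δ * g₉.dist y y')) :=
    mul_nonneg (mul_nonneg (mul_nonneg hC (Real.rpow_nonneg hlen.le _))
      (Real.rpow_nonneg (len_pos g₉ hL hη y').le _)) hexp
  rw [defectKernel_ker]
  calc |entry (D U) (ι y) y'|
      ≤ C * Real.exp (-(δ * g₉.dist y y')) * T4EtaRate.rateFactor g₉ γ y' * g₉.len y' ^ (-(d : ℝ)) *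
          g₉.len y ^ (-p) := E'
    _ = C * g₉.len y ^ (-p) * g₉.len y' ^ (-(d : ℝ)) * Real.exp (-(δ * g₉.dist y y')) *
          T4EtaRate.rateFactor g₉ γ y' := by ring
    _ ≤ C * g₉.len y ^ (-p) * g₉.len y' ^ (-(d : ℝ)) * Real.exp (-(δ * g₉.dist y y')) *
          max (T4EtaRate.rateFactor g₉ γ y) (T4EtaRate.rateFactor g₉ γ y') :=
        mul_le_mul_of_nonneg_left (le_max_right _ _) hfac

/-- **PRODUCER, uniform (the row's `NE2PlusSite` BY NAME).**  Over a family of paired instances, block majorants of the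
defect maps with constants `(M₅, δ, a₀, C, γ)` UNIFORM in the instance and the configuration — under the very quantifier
block of `T4EtaRate.NE2PlusSite` (M ≥ M₅, Mα₀ ≤ a₀, the regularity condition (3.35) on the fine configuration) — produce
`NE2PlusSite d p c35 pi (defect kernels)`.  Nothing is asserted: the block majorants are the hypothesis. [cite: Balaban1985BackgroundPropagators, Thm 3.2 (3.48) p.398 + Thm 3.14 pp.426–427 (quantifier template)] -/
theorem ne2PlusSite_of_hasMaj {I : Type} {d : ℕ} {p c35 : ℝ} (pi : I → T4EtaRate.PairedInstance)
    [∀ i, Fintype (pi i).gc.Site] [∀ i, DecidableEq (pi i).gc.Site] (Rg : I → ℝ) (Hg : I → Prop)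
    (X' : I → Type) [∀ i, Fintype (X' i)] (blk' : ∀ i, X' i → (pi i).gc.Site) (ι : ∀ i, (pi i).gc.Site → X' i)
    (hι : ∀ i y, blk' i (ι i y) = y) (hL : ∀ i, 0 < (pi i).gc.L) (hη : ∀ i, 0 < (pi i).gc.eta)
    (D : ∀ i, (pi i).Bf.Cfg → (((pi i).gc.Site → ℝ) →ₗ[ℝ] (X' i → ℝ)))
    (h : ∃ M₅ δ a₀ C γ : ℝ, 0 < M₅ ∧ 0 < δ ∧ 0 < a₀ ∧ 0 < C ∧ 0 < γ ∧
      ∀ i : I, M₅ ≤ (pi i).gf.M → ∀ α₀ : ℝ, 0 < α₀ → (pi i).gf.M * α₀ ≤ a₀ →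
        ∀ U : (pi i).Bf.Cfg, (pi i).Bf.Reg335 c35 α₀ U →
          HasMaj (srcNorm (pi i).gc (Rg i) (Hg i) (hL i).le (hη i).le d)
            (obsNorm (pi i).gc (Rg i) (Hg i) (hL i).le (hη i).le (blk' i) p) (D i U)
            (fun y y' => C * Real.exp (-(δ * (pi i).gc.dist y y')) *
              rateWeight (B9Thm34Ext.toB6 (pi i).gc (Rg i) (Hg i)) γ y')) :
    T4EtaRate.NE2PlusSite d p c35 pi (fun i => defectKernel (ι i) (D i)) := by
  obtain ⟨M₅, δ, a₀, C, γ, hM₅, hδ, ha₀, hC, hγ, hall⟩ := h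
  refine ⟨M₅, δ, a₀, C, γ, hM₅, hδ, ha₀, hC, hγ, fun i hM α₀ hα₀ ha U hU => ?_⟩
  exact etaRateIneqSite_of_hasMaj (blk' i) (ι i) (hι i) (hL i) (hη i) hC.le (D i) U (hall i hM α₀ hα₀ ha U hU)

end Producers

/-! ## §3 The composed producer: MAIN of `T4EtaRateDefect` in the (3.48)-normalised norms, read out -/

section Composed

variable {g₉ : B9.Geometry} [Fintype g₉.Site] [DecidableEq g₉.Site] {R : ℝ} {H : Prop}
variable {F₂ F₁' : Type} [AddCommGroup F₂] [Module ℝ F₂] [AddCommGroup F₁'] [Module ℝ F₁']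

/-- **COMPOSED PRODUCER, one configuration** (`T4EtaRateDefect.idef_neumann_majorant_rateWeight` ∘ readout).  Coarse run
`A = S + KA` from coarse site functions (norm `srcNorm d`) to a coarse value space `F₂` (any block norm `b₂`), fine run
`A′ = S′ + K′A′` into fine lattice functions on `X′` (norm `obsNorm blk′ p`), transports `τ₁`, `τ₂`; if the defect family
satisfies `D U = 𝔇(A′,A)` and the hypotheses of MAIN hold — coarse majorant `A₀e^{−(ρ+σ)d}` with `σ = γ·ln L/(RM)`, fine
step majorant `N′` with ρ-row constant `m′ < 1` (the observation norm cuts at cost 1), primitive defects `𝔇_S ≤ ε_S e^{−ρd}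
(L^{j′})^{−γ}`, `𝔇_K ≤ N_K·(L^{j′})^{−γ}` (ρ-row constant `m_K`), a priori bound `M₀(L^{j′})^{−γ}`, [B6] (2.54)/(2.60) for
the geometry — then the defect kernel obeys `EtaRateIneqSite d p` at the configuration `U` with constant
`(ε_S + κ₂m_KA₀L^γ)(1 − m′)⁻¹`, decay rate `ρ`, rate exponent `γ`.  Census (N1)–(N6) of the first leaf applies verbatim;
NOT NE2⁺ (the primitive majorants are the hypothesis). [cite: Balaban1985BackgroundPropagators, Thm 3.2 (3.48) p.398 + Thm 3.14 pp.426–427 (mechanism); Balaban1984PropagatorsII, Lemma 2.1 (2.60) p.234 (shape)] -/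
theorem etaRateIneqSite_of_primitives {Bf : B9.Backgrounds} {X' : Type} [Fintype X'] (blk' : X' → g₉.Site)
    (ι : g₉.Site → X') (hι : ∀ y, blk' (ι y) = y) (hL1 : 1 ≤ g₉.L) (hη : 0 < g₉.eta) {d : ℕ} {p : ℝ}
    (D : Bf.Cfg → ((g₉.Site → ℝ) →ₗ[ℝ] (X' → ℝ))) (U : Bf.Cfg)
    {b₂ : BlockNorm (B9Thm34Ext.toB6 g₉ R H) F₂}
    {τ₁ : (g₉.Site → ℝ) →ₗ[ℝ] F₁'} {τ₂ : F₂ →ₗ[ℝ] (X' → ℝ)}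
    {K : Module.End ℝ F₂} {K' : Module.End ℝ (X' → ℝ)} {S A : (g₉.Site → ℝ) →ₗ[ℝ] F₂}
    {S' A' : F₁' →ₗ[ℝ] (X' → ℝ)}
    {N_K N' : g₉.Site → g₉.Site → ℝ} {εS mK m' A₀ M₀ ρ γ δ₀ α : ℝ}
    (hD : D U = idef τ₁ τ₂ A' A)
    (htri : Triangle254 (B9Thm34Ext.toB6 g₉ R H)) (hd : ∀ a b : g₉.Site, 0 ≤ g₉.dist a b) (hρ : 0 ≤ ρ)
    (h260 : Ineq260 (B9Thm34Ext.toB6 g₉ R H) δ₀ α) (hαδ : 0 < α * δ₀) (hγ : 0 ≤ γ) (hRM : 0 < R * g₉.M)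
    (hεS : 0 ≤ εS) (hA₀ : 0 ≤ A₀) (hM₀ : 0 ≤ M₀)
    (hNK : ∀ x y, 0 ≤ N_K x y) (hmK : WRow (B9Thm34Ext.toB6 g₉ R H) ρ N_K mK)
    (hN' : ∀ x y, 0 ≤ N' x y) (hm' : WRow (B9Thm34Ext.toB6 g₉ R H) ρ N' m')
    (hfix : A = S + K ∘ₗ A) (hfix' : A' = S' + K' ∘ₗ A')
    (hA : HasMaj (srcNorm g₉ R H (zero_le_one.trans hL1) hη.le d) b₂ A
      (fun y y' => A₀ * Real.exp (-((ρ + γ * Real.log g₉.L / (R * g₉.M)) * g₉.dist y y'))))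
    (hK' : HasMaj (obsNorm g₉ R H (zero_le_one.trans hL1) hη.le blk' p)
      (obsNorm g₉ R H (zero_le_one.trans hL1) hη.le blk' p) K' N')
    (hDS : HasMaj (srcNorm g₉ R H (zero_le_one.trans hL1) hη.le d)
      (obsNorm g₉ R H (zero_le_one.trans hL1) hη.le blk' p) (idef τ₁ τ₂ S' S)
      (fun y y' => εS * Real.exp (-(ρ * g₉.dist y y')) * rateWeight (B9Thm34Ext.toB6 g₉ R H) γ y'))
    (hDK : HasMaj b₂ (obsNorm g₉ R H (zero_le_one.trans hL1) hη.le blk' p) (idef τ₂ τ₂ K' K)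
      (fun y y' => N_K y y' * rateWeight (B9Thm34Ext.toB6 g₉ R H) γ y'))
    (hap : HasMaj (srcNorm g₉ R H (zero_le_one.trans hL1) hη.le d)
      (obsNorm g₉ R H (zero_le_one.trans hL1) hη.le blk' p) (idef τ₁ τ₂ A' A)
      (fun _ y' => M₀ * rateWeight (B9Thm34Ext.toB6 g₉ R H) γ y'))
    (hq' : m' < 1) :
    T4EtaRate.EtaRateIneqSite d p (defectKernel ι D)
      ((εS + b₂.κ * mK * A₀ * g₉.L ^ γ) * (1 - m')⁻¹) ρ γ U := by
  have hL : 0 < g₉.L := lt_of_lt_of_le one_pos hL1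
  have hq'' : (obsNorm g₉ R H (zero_le_one.trans hL1) hη.le blk' p).κ * m' < 1 := by
    rw [obsNorm_κ, one_mul]; exact hq'
  have M := idef_neumann_majorant_rateWeight (g := B9Thm34Ext.toB6 g₉ R H) htri hd hρ h260 hαδ hL1 hγ hRM
    hεS hA₀ hM₀ hNK hmK hN' hm' hfix hfix' hA hK' hDS hDK hap hq''
  rw [obsNorm_κ, one_mul] at M
  intro y y'
  have hconst : 0 ≤ (εS + b₂.κ * mK * A₀ * g₉.L ^ γ) * (1 - m')⁻¹ := by
    have h1 : 0 ≤ b₂.κ * mK * A₀ * g₉.L ^ γ :=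
      mul_nonneg (mul_nonneg (mul_nonneg b₂.κ_nonneg (hmK.nonneg hNK y)) hA₀)
        (Real.rpow_nonneg hL.le γ)
    exact mul_nonneg (add_nonneg hεS h1) (inv_nonneg.mpr (by linarith))
  refine etaRateIneqSite_of_hasMaj (R := R) (H := H) blk' ι hι hL hη hconst D U ?_ y y'
  rw [hD]
  intro z' μ hμ z
  have := M z' μ hμ z
  simpa [mul_assoc] using this

end Composed

/-! ## §4 Non-vacuity: the one-point instance meets the producer's hypotheses (scalar model of the first leaf) -/

section Toy

/-- The one-point B9 geometry (one site of scale 0, `η = 1`, `L = 2`, `M = 1`, all argument sizes `0`); `reducible` so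
that the `Unit` instances are found on `pt9Geo.Site`. [folklore] -/
@[reducible] def pt9Geo : B9.Geometry where
  Site := Unit
  scale := fun _ => 0
  dist := fun _ _ => 0
  k := 0
  eta := 1
  L := 2
  M := 1
  Loc := Unit
  suppIn := fun _ _ => True
  suppInT := fun _ _ => True
  supNorm := fun _ => 0
  l2Norm := fun _ => 0
  wNorm := fun _ _ => 0
  holder := fun _ _ => 0
  Cut := Unit
  cutIn := fun _ _ => True
  cutInT := fun _ _ => True
  cutH := fun _ _ => 0
  cutSup := fun _ => 0
  suppInT_of_suppIn := fun _ _ h => h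
  cutInT_of_cutIn := fun _ _ h => h

/-- The one-point background carrier (one configuration, all conditions true). [folklore] -/
@[reducible] def pt9Bg : B9.Backgrounds where
  Cfg := Unit
  one := ()
  mul := fun _ _ => ()
  Reg335 := fun _ _ _ => True
  Reg336 := fun _ _ _ => True
  Cplx337 := fun _ _ _ => True
  Cplx338 := fun _ _ _ => True

/-- On the one-point instance every site length is `1`. [folklore] -/
@[simp] theorem pt9Geo_len (y : pt9Geo.Site) : pt9Geo.len y = 1 := by
  simp [B9.Geometry.len]

/-- On the one-point instance the distance is `0`. [folklore] -/
@[simp] theorem pt9Geo_dist (y y' : pt9Geo.Site) : pt9Geo.dist y y' = 0 := rfl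

/-- On the one-point instance the η-rate weight is `1`. [folklore] -/
@[simp] theorem rateWeight_pt (R : ℝ) (H : Prop) (γ : ℝ) (y : pt9Geo.Site) :
    rateWeight (B9Thm34Ext.toB6 pt9Geo R H) γ y = 1 := by
  simp [rateWeight, B9Thm34Ext.toB6, pt9Geo]

/-- The scalar defect family: `D () = 𝔇(a′·1, a·1) = (a′ − a)·1` through identity transports. [folklore] -/
def pt9Defect (a a' : ℝ) : pt9Bg.Cfg → ((pt9Geo.Site → ℝ) →ₗ[ℝ] (pt9Geo.Site → ℝ)) :=
  fun _ => idef LinearMap.id LinearMap.id (a' • LinearMap.id) (a • LinearMap.id)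

/-- The scalar defect acts as multiplication by `a′ − a`. [folklore] -/
theorem pt9Defect_apply (a a' : ℝ) (U : pt9Bg.Cfg) (μ : pt9Geo.Site → ℝ) :
    pt9Defect a a' U μ = (a' - a) • μ := by
  simp [pt9Defect, idef, sub_smul]

/-- The producer's hypothesis holds on the one-point instance with `C = |a′ − a|` (weights `d = 0`, `p = 0`). [folklore] -/
theorem hasMaj_pt (R : ℝ) (H : Prop) (a a' γ : ℝ) (U : pt9Bg.Cfg) :
    HasMaj (srcNorm pt9Geo R H (by norm_num [pt9Geo]) (by norm_num [pt9Geo]) 0)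
      (obsNorm pt9Geo R H (by norm_num [pt9Geo]) (by norm_num [pt9Geo]) (fun y : pt9Geo.Site => y) 0)
      (pt9Defect a a' U)
      (fun y y' => |a' - a| * Real.exp (-(0 * pt9Geo.dist y y')) *
        rateWeight (B9Thm34Ext.toB6 pt9Geo R H) γ y') := by
  refine (hasMaj_site_iff (g₉ := pt9Geo) (R := R) (H := H) _ _).mpr ?_
  intro y y'
  cases y; cases y'
  simp [entry, pt9Defect, idef]

/-- NON-VACUITY: the producer returns the row's site-kernel inequality on the one-point instance with constant
`|a′ − a|`, decay rate `0`, any rate exponent. [folklore] -/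
theorem etaRateIneqSite_pt (R : ℝ) (H : Prop) (a a' γ : ℝ) (U : pt9Bg.Cfg) :
    T4EtaRate.EtaRateIneqSite 0 0 (defectKernel (fun y : pt9Geo.Site => y) (pt9Defect a a')) |a' - a| 0 γ U :=
  etaRateIneqSite_of_hasMaj (g₉ := pt9Geo) (R := R) (H := H) (fun y : pt9Geo.Site => y) (fun y => y)
    (fun _ => rfl) (by norm_num [pt9Geo]) (by norm_num [pt9Geo]) (abs_nonneg _) (pt9Defect a a') U
    (hasMaj_pt R H a a' γ U)

/-- … and the kernel it bounds is literally `a′ − a`. [folklore] -/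
example (a a' : ℝ) (U : pt9Bg.Cfg) (y y' : pt9Geo.Site) :
    (defectKernel (fun y : pt9Geo.Site => y) (pt9Defect a a')).ker U y y' = a' - a := by
  cases y; cases y'
  simp [entry, pt9Defect, idef]

end Toy

end

end Literature.MathematicalPhysics.QuantumFieldTheory.Balaban1983to89.T4EtaRateDefectSite
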